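import Summits.QuantumFields.QCD.Theses.QuarksNoInfraredClause
import Literature.MathematicalPhysics.QuantumFieldTheory.QCDFlavourSymmetry

/-!
# `ThinQCD` (crux stmt-QuantumFields-17278) — negative-side support: the flavour guard is load-bearing

Refuter vetting pass (crux-attack, 2026-08-17). `ThinQCD` asserts its body only for `N_f = 2` and
`N_f = 3`. This definition-free file records, kernel-checked, that the guard cannot be dropped: the
`N_f = 0` instance of the SAME body (the text after `Nf = 2 ∨ Nf = 3 →`, with `Nf := 0`) is FALSE.
Mechanism (the thin analogue of `ChiralDescent.Negative.not_qcdOf_zero` for the re-typed `QCDOf`):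
with no quark variables the vector flavour torus acts trivially, so every gauge-invariant local
observable is flavour-NEUTRAL (`exteriorMap_eq_self_of_flavourless`, `isFlavourNeutral_of_flavourless`);
hence ThinQCD's neutral-sector clustering clause at the unique (vacuous) mass tuple is the FULL
lattice gap `HasLatticeMassGap (2Δ)`, which the pin `reg.IsChiralAtZero` denies at `ε := 2Δ`
(`not_isChiralAtZero_of_latticeGap_flavourless`). So the thinning (neutral pairs only) does not
rescue the pure-glue flank: at `N_f = 0` the crux would say "some asymptotically free pure-`SU(3)`
Wilson scheme is both uniformly gapped and not uniformly gapped". Informative for provers: any proof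
of `ThinQCD` must use `N_f ≥ 1` (physically `N_f ≥ 2`: the pin imports Goldstone gaplessness, absent
for `N_f ≤ 1`). Not a refutation of the crux (its guard excludes `N_f = 0`).
-/

noncomputable section

namespace Summit.QuantumFields.QCD.Theorems.ThinQCD.Negative

open Filter Literature.MathematicalPhysics.QuantumFieldTheory

/-- With no flavours there are no boxed quark variables. [folklore] -/
theorem isEmpty_boxFermiIdx_zero (R : ℕ) : IsEmpty (BoxFermiIdx 0 R) :=
  ⟨fun i => absurd i.isLt (by simp)⟩

/-- **With no flavours every change of generators acts trivially on the boxed Grassmann algebra**: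
the generator module `(∅ → ℂ)` is a singleton, so any linear map on it is the identity and so is
the induced algebra map (in particular every weight of the vector flavour torus). [folklore] -/
theorem exteriorMap_eq_self_of_flavourless {R : ℕ}
    (L : ((BoxFermiIdx 0 R ⊕ₗ BoxFermiIdx 0 R) → ℂ) →ₗ[ℂ] ((BoxFermiIdx 0 R ⊕ₗ BoxFermiIdx 0 R) → ℂ))
    (x : BoxFermiAlg 0 R) : ExteriorAlgebra.map L x = x := by
  haveI : IsEmpty (BoxFermiIdx 0 R) := isEmpty_boxFermiIdx_zero R
  haveI : IsEmpty (BoxFermiIdx 0 R ⊕ₗ BoxFermiIdx 0 R) := ⟨fun w => isEmptyElim (ofLex w)⟩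
  have hL : L = LinearMap.id := LinearMap.ext fun _ => Subsingleton.elim _ _
  rw [hL, ExteriorAlgebra.map_id, AlgHom.id_apply]

/-- **At `N_f = 0` every gauge-invariant local observable is flavour-neutral.** [folklore] -/
theorem isFlavourNeutral_of_flavourless {R : ℕ} (A : QCDLatticeObservable 0 R) : A.IsFlavourNeutral :=
  fun _ _ _ => exteriorMap_eq_self_of_flavourless _ _

/-- At `N_f = 0` the neutral-sector lattice gap IS the full lattice gap. [folklore] -/
theorem hasNeutralLatticeMassGap_iff_of_flavourless (sch : QCDScheme 0) (Δ : ℝ) :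
    sch.HasNeutralLatticeMassGap Δ ↔ sch.HasLatticeMassGap Δ :=
  ⟨fun h R R' A B => h R R' A B (isFlavourNeutral_of_flavourless A) (isFlavourNeutral_of_flavourless B),
    fun h => h.neutral⟩

/-- **Pin versus gap with no flavours.** A flavourless regularisation whose (unique, vacuous) mass
tuple carries a positive-rate lattice gap for some species renormalisations is not chiral at zero
(the gap clause never reads `z, shift`, so it transports to `reg.scheme m 0 0` definitionally). [folklore] -/
theorem not_isChiralAtZero_of_latticeGap_flavourless (reg : QCDRegularisation 0)
    (h : ∀ m : Fin 0 → ℝ, ∃ (z shift : QCDField 0 → ℕ → ℝ) (Δ : ℝ), 0 < Δ ∧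
      (reg.scheme m z shift).HasLatticeMassGap Δ) :
    ¬ reg.IsChiralAtZero := by
  intro hχ
  obtain ⟨z, shift, Δ, hΔ, hgap⟩ := h (fun f => f.elim0)
  obtain ⟨m', -, hno⟩ := hχ Δ hΔ
  obtain rfl : m' = fun f => f.elim0 := Subsingleton.elim _ _
  -- the gap clause reads only `β_k, L_k, a_k, m_f(k)` (never `z, shift`): definitional transport
  -- (`RobustYangMillsHandover.Negative.hasLatticeMassGap_scheme_indep`, not imported here)
  exact hno hgap

/-- The same with a NEUTRAL-sector gap in the hypothesis (all observables are neutral at `N_f = 0`). [folklore] -/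
theorem not_isChiralAtZero_of_neutralGap_flavourless (reg : QCDRegularisation 0)
    (h : ∀ m : Fin 0 → ℝ, ∃ (z shift : QCDField 0 → ℕ → ℝ) (Δ : ℝ), 0 < Δ ∧
      (reg.scheme m z shift).HasNeutralLatticeMassGap Δ) :
    ¬ reg.IsChiralAtZero :=
  not_isChiralAtZero_of_latticeGap_flavourless reg fun m => by
    obtain ⟨z, shift, Δ, hΔ, hN⟩ := h m
    exact ⟨z, shift, Δ, hΔ, (hasNeutralLatticeMassGap_iff_of_flavourless _ Δ).1 hN⟩

/-- **The flavour guard of `ThinQCD` is load-bearing**: the `N_f = 0` instance of the crux's body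
(verbatim, `Nf := 0`) is false — the pin `IsChiralAtZero` contradicts the neutral (= full, at
`N_f = 0`) lattice gap clause at the vacuous mass tuple. [folklore] -/
theorem not_thinQCD_body_zero : ¬ (open Literature.MathematicalPhysics.QuantumFieldTheory in
    ∃ reg : QCDRegularisation 0, reg.HasMassScaling ∧ reg.IsChiralAtZero ∧ ∀ m : Fin 0 → ℝ, (∀ f, 0 < m f) → ∃ (z shift : QCDField 0 → ℕ → ℝ) (T : OSData (QCDField 0) 4), IsQCDAlong (reg.scheme m z shift) T ∧ (∃ f g : SchwartzMap (EuclideanSpace ℝ (Fin 4)) ℝ, tsupport (f : EuclideanSpace ℝ (Fin 4) → ℝ) ⊆ {x | x 0 < 0} ∧ tsupport (g : EuclideanSpace ℝ (Fin 4) → ℝ) ⊆ {x | 0 < x 0} ∧ ∃ ε > (0 : ℝ), ∀ᶠ k in Filter.atTop, ε ≤ ‖qcdLatticeSchwinger (reg.scheme m z shift) k 2 ![QCDField.glue, QCDField.glue] ![f, g] - qcdLatticeSchwinger (reg.scheme m z shift) k 1 ![QCDField.glue] ![f] * qcdLatticeSchwinger (reg.scheme m z shift) k 1 ![QCDField.glue]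 ![g]‖) ∧ (∀ f₁ f₂ : Fin 0, f₁ ≠ f₂ → (∃ f g : SchwartzMap (EuclideanSpace ℝ (Fin 4)) ℝ, tsupport (f : EuclideanSpace ℝ (Fin 4) → ℝ) ⊆ {x | x 0 < 0} ∧ tsupport (g : EuclideanSpace ℝ (Fin 4) → ℝ) ⊆ {x | 0 < x 0} ∧ ∃ ε > (0 : ℝ), ∀ᶠ k in Filter.atTop, ε ≤ ‖qcdLatticeSchwinger (reg.scheme m z shift) k 2 ![(QCDField.pseudoRe f₁ f₂), (QCDField.pseudoRe f₁ f₂)] ![f, g] - qcdLatticeSchwinger (reg.scheme m z shift) k 1 ![(QCDField.pseudoRe f₁ f₂)] ![f] * qcdLatticeSchwinger (reg.scheme m z shift) k 1 ![(QCDField.pseudoRe f₁ f₂)] ![g]‖)) ∧ (∃ f g h : SchwartzMap (EuclideanSpace ℝ (Fin 4)) ℝ, tsupport (f : EuclideanSpace ℝ (Fin 4) → ℝ) ⊆ {x | x 0 < 0} ∧ tsupport (g : EuclideanSpace ℝ (Fin 4) → ℝ) ⊆ {x | 0 < x 0 ∧ x 0 < 1} ∧ tsupport (h : EuclideanSpace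 ℝ (Fin 4) → ℝ) ⊆ {x | 1 < x 0} ∧ ∃ ε > (0 : ℝ), ∀ᶠ k in Filter.atTop, ε ≤ ‖qcdLatticeSchwinger (reg.scheme m z shift) k 3 ![QCDField.glue, QCDField.glue, QCDField.glue] ![f, g, h] - qcdLatticeSchwinger (reg.scheme m z shift) k 1 ![QCDField.glue] ![f] * qcdLatticeSchwinger (reg.scheme m z shift) k 2 ![QCDField.glue, QCDField.glue] ![g, h] - qcdLatticeSchwinger (reg.scheme m z shift) k 1 ![QCDField.glue] ![g] * qcdLatticeSchwinger (reg.scheme m z shift) k 2 ![QCDField.glue, QCDField.glue] ![f, h] - qcdLatticeSchwinger (reg.scheme m z shift) k 1 ![QCDField.glue] ![h] * qcdLatticeSchwinger (reg.scheme m z shift) k 2 ![QCDField.glue, QCDField.glue] ![f, g] + 2 * (qcdLatticeSchwinger (reg.scheme m z shift) k 1 ![QCDField.glue] ![f] * qcdLatticeSchwinger (reg.scheme m z shift) k 1 ![QCDField.glue] ![g] * qcdLatticeSchwinger (reg.scheme m z shift) k 1 ![QCDField.glue] ![h])‖) ∧ ∃ Δ > 0, T.HasMassGap Δ ∧ (∀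 (R R' : ℕ) (A : QCDLatticeObservable 0 R) (B : QCDLatticeObservable 0 R'), (∀ t : Fin 0 → ℂ, (∀ f, t f ≠ 0) → ∀ U, ExteriorAlgebra.map (LinearMap.pi fun w : BoxFermiIdx 0 R ⊕ₗ BoxFermiIdx 0 R => (match ofLex w with | Sum.inl i => (t (boxQuarkEquiv.symm i).1)⁻¹ | Sum.inr i => t (boxQuarkEquiv.symm i).1) • LinearMap.proj w) (A.F U) = A.F U) → (∀ t : Fin 0 → ℂ, (∀ f, t f ≠ 0) → ∀ U, ExteriorAlgebra.map (LinearMap.pi fun w : BoxFermiIdx 0 R' ⊕ₗ BoxFermiIdx 0 R' => (match ofLex w with | Sum.inl i => (t (boxQuarkEquiv.symm i).1)⁻¹ | Sum.inr i => t (boxQuarkEquiv.symm i).1) • LinearMap.proj w) (B.F U) = B.F U) → ∃ C : ℝ, ∀ᶠ k in Filter.atTop, ∀ S : ℕ, (reg.scheme m z shift).L k ≤ S → ∀ n : ℕ, n ≤ S → ‖qcdLatticeConnectedCorr ((reg.scheme m z shift).β k) (2 * S + 1) (fun fl => (reg.scheme m z shift).mq fl k) A B n‖ ≤ C * Real.exp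 (-(2 * Δ * ((reg.scheme m z shift).a k * n))))) := by
  rintro ⟨reg, -, hχ, hbody⟩
  refine not_isChiralAtZero_of_latticeGap_flavourless reg (fun m => ?_) hχ
  obtain ⟨z, shift, T, -, -, -, -, Δ, hΔ, -, hN⟩ := hbody m (fun f => f.elim0)
  exact ⟨z, shift, 2 * Δ, by positivity, fun R R' A B =>
    hN R R' A B (fun _ _ _ => exteriorMap_eq_self_of_flavourless _ _)
      (fun _ _ _ => exteriorMap_eq_self_of_flavourless _ _)⟩

end Summit.QuantumFields.QCD.Theorems.ThinQCD.Negative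

end
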